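import Summits.CriticalPhenomena.SAWScalingLimit.Theses.SAWQuarterTwist
import Summits.CriticalPhenomena.SAWScalingLimit.Theorems.MassRatio.Negative.Tools

/-!
# Line `spin-tilt-vitali` — registered skeleton for the crux `BulkScalingLimitExists` (stmt-CriticalPhenomena-16651)

Crux (FIXED; rank 3 of `route-CriticalPhenomena-SAWQuarterTwist`): along every admissible family of hexagonal
discretisations `Λ_δ` of a Dobrushin domain with an interior source cell `x_δ → p`, the smeared quarter-twisted
parafermion `⟨ψ, F^tw_δ⟩ = Σ_e ψ(δ·mid e) F^tw_δ(e)`, `F^tw_δ(e) = Σ_γ x_c^ℓ e^{-i(5/8)W(γ)} i^{N(γ)}`, has a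
non-degenerate projective limit: `ψ`-independent normalisers `n_δ` and a functional `ℓ ≢ 0` with
`n_δ δ² ⟨ψ, F^tw_δ⟩ → ℓ ψ` for every bulk test function `ψ ∈ C_c(Ω ∖ p)`.

## The cut — COMPLEXIFY THE SPIN ALONG THE LINE THROUGH THE POSITIVE POINT, TRANSPORT BY VITALI

Write the physical weight as the value at `w⋆ = -5i/8` of an ENTIRE one-parameter family:
`x_c^ℓ e^{-i(5/8)W} i^N = x_c^ℓ exp(w⋆ · T(γ))`, `T(γ) := W(γ) − (4π/5)·N(γ) ∈ ℝ` (`W` = total turning,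
`N` = signed cut crossings, both the crux's own), since `e^{w⋆T} = e^{-i5W/8} e^{iπN/2}`. The family
`E_δ(w; ψ) := Σ_e ψ(δ mid e) Σ_γ x_c^ℓ e^{-i(5/8)W} i^N e^{(w − w⋆)T}` (`spinPairing`) is entire in `w`, equals the
crux pairing at `w = w⋆` (proved below, `spinPairing_wstar`), and for REAL `w = s` it is the smeared two-point
function of a POSITIVE ensemble: the critical SAW from the interior source with turn weights `x_c e^{±sπ/3}`
and a real flux `e^{-(4π/5)s}` through the cut (every walk weight is `x_c^ℓ e^{sT(γ)} > 0`). In the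
two-parameter space (spin `σ`, flux `u`) this is the complex line through the positive point `(0, 1)` and the
physical point `(5/8, i)`: `σ(w) = iw`, `u(w) = e^{-(4π/5)w}`.

* V1 `stub_vitaliPorter` (CLASSICAL — Vitali–Porter/Montel along the filter `𝓝[>] 0`; deterministic, landable,
  size L): a family of holomorphic functions on a connected open `U ⊆ ℂ`, eventually uniformly bounded on `U`,
  which converges pointwise on a subset `S ⊆ U` having an accumulation point in `U`, converges pointwise on
  all of `U`.
* V3 `stub_spinAnchor` (OPEN — the a-priori / non-cancellation input, on a STRIP): for admissible data there
  are `ε > 0` and a bulk test function `ψ₀` (an ANCHOR) such that eventually in `δ` the anchor pairing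
  `E_δ(w; ψ₀)` has no zero in the box `U_ε = {|Re w| < ε, −5/8 − ε < Im w < ε}` (which contains the real
  segment `(−ε, ε)` and the physical point `w⋆`), and every bulk pairing is dominated there:
  `‖E_δ(w; ψ)‖ ≤ C_ψ ‖E_δ(w; ψ₀)‖` for all `w ∈ U_ε`, eventually.
* V2 `stub_realSpinLimit` (OPEN — the POSITIVE-WORLD limit): for admissible data, every anchor `ψ₀` and every
  real `s ∈ (−ε, ε)`, the ratios `E_δ(s; ψ)/E_δ(s; ψ₀)` of smeared POSITIVE tilted two-point functions
  converge as `δ → 0⁺`, for every bulk test function `ψ`.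

Composition (kernel-checked, no `sorry` of its own): anchor from V3; for a bulk `ψ` the normalised family
`R_δ(w) = E_δ(w;ψ)/E_δ(w;ψ₀)` is eventually holomorphic and bounded by `C_ψ` on the convex open box `U_ε`; by
V2 it converges on the real segment, which accumulates at `0 ∈ U_ε`; V1 transports the convergence to
`w⋆ ∈ U_ε`; with `n_δ := (δ² E_δ(w⋆; ψ₀))⁻¹` the crux's normalised pairing IS `R_δ(w⋆)` for `δ > 0`, and
`ℓ ψ₀ = lim R_δ(w⋆; ψ₀) = 1 ≠ 0`. UNIQUENESS of the limit at the physical point is inherited from the positive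
axis through the identity theorem inside Vitali — no identification of the limit, no boundary law
(census F2: none exists at `σ = 5/8`), no Riemann–Hilbert problem.

Why THIS family and not the integer-charge tilt of `Ideas/vitali-in-the-twist` / `zero-free-twist` (line card
§F1): tilting an integer winding charge `J` at fixed spin detunes the arrival-parity cancellation that makes the
undirected observable `ψ`-dominated — the leading `Φ'` channel (`Δ = 7/24 < 5/8`) re-enters with amplitude
`∝ |w − w⋆|·δ^{-1/3}`, so zeros of every anchor pairing accumulate AT the physical point and no box around it is
admissible. Complexifying the spin keeps the parity projection `w`-independent (channel chart in the card: no
crossing on `Im w ∈ [−5/8, 0]`, nearest crossings at `Im w = −5/6, −1`).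

Disproof / negatives used: no `Cruxes/BulkScalingLimitExists/Disproof.lean` exists (2026-08-17), no
`_false_without_` theorem, no landed `Theorems/BulkScalingLimitExists/Negative/*`. CRUX-ATTACK-g1 honoured:
content = ratio convergence (`limit_ray_unique`) — the line produces the ray; `F = F↑ + F↓` two-sided start —
both start half-edges are summed in `spinFamily` exactly as in the crux. Negatives 0772 / 5420 / 8312 untouched
(bulk source, bulk self-normalisation, eventual in `δ`).
-/

noncomputable section

-- the route file's scopes, re-opened verbatim so that elaboration (instances of the `if`s, coercions)
-- coincides with the crux's and `bulkScalingLimitExists_iff` below is `Iff.rfl`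
open scoped BigOperators Topology Manifold Classical MeasureTheory ProbabilityTheory Matrix InnerProductSpace ComplexConjugate ContinuousMap
open Filter Set Function TopologicalSpace MeasureTheory
open Literature.Probability.RandomPlanarGeometry Literature.Probability.LatticeModels

namespace Summit.CriticalPhenomena.SAWScalingLimit.Cruxes.BulkScalingLimitExists.SpinTiltVitali

/-! ### 1. Vocabulary — the crux's three `let`s as definitions (VERBATIM `Lines/birth.lean` §1), then the spin-tilt family -/

/-- The cut sign of a directed lattice step (VERBATIM the crux's `let sgn`). -/
def sgn (x : ℝ → Site 2) : ℝ → HexVertex → HexVertex → ℤ := fun s p q =>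
  if q.2 = 0 ∧ p.2 = 1 ∧ p.1 = q.1 - Pi.single 1 1 ∧ q.1 1 = x s 1 ∧ x s 0 ≤ q.1 0 then 1
  else if p.2 = 0 ∧ q.2 = 1 ∧ q.1 = p.1 - Pi.single 1 1 ∧ p.1 1 = x s 1 ∧ x s 0 ≤ p.1 0 then -1 else 0

/-- The source mid-edge: the left vertical side of the hexagon at the cell `x s` (VERBATIM the crux's `let a`). -/
def src (x : ℝ → Site 2) : ℝ → Sym2 HexVertex := fun s =>
  s((x s - Pi.single 0 1, (0 : Fin 2)), (x s - Pi.single 0 1 - Pi.single 1 1, (1 : Fin 2)))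

/-- The signed number `N(γ)` of cut crossings of a walk (the exponent of `Complex.I` in the crux's `let F`). -/
def cutCount (x : ℝ → Site 2) (s : ℝ) {Λ' : Finset HexVertex} {a z : Sym2 HexVertex}
    (γ : Literature.Probability.RandomPlanarGeometry.SAW.HexMidEdgeSAW Λ' a z) : ℤ :=
  ((γ.verts.zip γ.verts.tail).map (fun pq => sgn x s pq.1 pq.2)).sum

/-- The quarter-twisted interior-source parafermion `F^tw_s(z)` (VERBATIM the crux's `let F`). -/
def Ftw (Λ : ℝ → Finset HexVertex) (x : ℝ → Site 2) : ℝ → Sym2 HexVertex → ℂ := fun s z =>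
  ∑ γ : Literature.Probability.RandomPlanarGeometry.SAW.HexMidEdgeSAW (Λ s) (src x s) z,
    γ.weight Literature.Probability.RandomPlanarGeometry.SAW.hexCriticalFugacity (5 / 8) *
      Complex.I ^ ((γ.verts.zip γ.verts.tail).map (fun pq => sgn x s pq.1 pq.2)).sum

/-- The smeared pairing `⟨ψ, F_δ⟩ := Σ_{e ∈ midEdges Λ_δ} ψ(δ · mid e) F^tw_δ(e)` (the crux's `finsum`). -/
def pairing (Λ : ℝ → Finset HexVertex) (x : ℝ → Site 2) (ψ : ℂ → ℂ) (δ : ℝ) : ℂ :=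
  ∑ᶠ e ∈ Literature.Probability.RandomPlanarGeometry.SAW.hexDomainMidEdges (Λ δ),
    ψ ((δ : ℂ) * Literature.Probability.RandomPlanarGeometry.SAW.hexMidpoint e) * Ftw Λ x δ e

/-- Bulk test functions of `(Ω, p)`: `ψ ∈ C_c(Ω ∖ {p})` (VERBATIM the crux's three hypotheses on `ψ`). -/
def IsBulkTest (D : DobrushinDomain) (p : ℂ) (ψ : ℂ → ℂ) : Prop :=
  Continuous ψ ∧ HasCompactSupport ψ ∧ tsupport ψ ⊆ D.carrier \ {p}

/-- Admissible data `(D, p, ρ, Λ, x)`: the conjunction of the crux's six hypotheses, VERBATIM. -/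
def Admissible (D : DobrushinDomain) (p : ℂ) (ρ : ℝ) (Λ : ℝ → Finset HexVertex) (x : ℝ → Site 2) : Prop :=
  p ∈ D.carrier ∧ 0 < ρ ∧ Metric.ball p ρ ⊆ D.carrier ∧
  (∀ᶠ δ : ℝ in nhdsWithin 0 (Set.Ioi 0),
    Literature.Probability.RandomPlanarGeometry.SAW.hexDomainSimplyConnected (Λ δ) ∧
    (hexGraph.induce ((Λ δ : Finset HexVertex) : Set HexVertex)).Preconnected ∧
    (∀ v ∈ Λ δ, (δ : ℂ) * hexCenter v ∈ D.carrier) ∧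
    (∀ v : HexVertex, (δ : ℂ) * hexCenter v ∈ Metric.ball p ρ → v ∈ Λ δ)) ∧
  (∀ K : Set ℂ, IsCompact K → K ⊆ D.carrier → ∀ᶠ δ : ℝ in nhdsWithin 0 (Set.Ioi 0),
    ∀ v : HexVertex, (δ : ℂ) * hexCenter v ∈ K → v ∈ Λ δ) ∧
  Filter.Tendsto (fun δ : ℝ => (δ : ℂ) * triEmbed (x δ)) (nhdsWithin 0 (Set.Ioi 0)) (nhds p)

/-- **The real tilt charge** `T(γ) = W(γ) − (4π/5)·N(γ)`: total turning minus `4π/5` per signed cut crossing.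
`e^{wT}` is the weight of the spin-tilt family; at `w = w⋆ = −5i/8` it is the crux's phase
`e^{-i(5/8)W} i^N`, and for real `w` it is positive. -/
def tcharge (x : ℝ → Site 2) (s : ℝ) {Λ' : Finset HexVertex} {a z : Sym2 HexVertex}
    (γ : Literature.Probability.RandomPlanarGeometry.SAW.HexMidEdgeSAW Λ' a z) : ℝ :=
  γ.winding - (4 * Real.pi / 5) * (cutCount x s γ : ℝ)

/-- The physical point `w⋆ = −5i/8` of the spin-tilt family. -/
def wstar : ℂ := -(5 / 8 : ℂ) * Complex.I

/-- **The spin-tilt family** `E_s(w; z) = Σ_γ x_c^ℓ e^{-i(5/8)W} i^N · e^{(w − w⋆) T(γ)}` over the SAWs of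
`Λ s` from the source to `z`: the crux's summand times `exp((w − w⋆)T)`, so that `w = w⋆` gives `F^tw_s(z)` on
the nose (`spinFamily_wstar`) and real `w` gives positive weights `x_c^ℓ e^{wT}`. Entire in `w`. -/
def spinFamily (Λ : ℝ → Finset HexVertex) (x : ℝ → Site 2) (s : ℝ) (w : ℂ) (z : Sym2 HexVertex) : ℂ :=
  ∑ γ : Literature.Probability.RandomPlanarGeometry.SAW.HexMidEdgeSAW (Λ s) (src x s) z,
    γ.weight Literature.Probability.RandomPlanarGeometry.SAW.hexCriticalFugacity (5 / 8) *
      Complex.I ^ cutCount x s γ * Complex.exp ((w - wstar) * (tcharge x s γ : ℂ))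

/-- The smeared spin-tilt pairing `E_δ(w; ψ) = Σ_{e ∈ midEdges Λ_δ} ψ(δ · mid e) E_δ(w; e)`. -/
def spinPairing (Λ : ℝ → Finset HexVertex) (x : ℝ → Site 2) (ψ : ℂ → ℂ) (δ : ℝ) (w : ℂ) : ℂ :=
  ∑ᶠ e ∈ Literature.Probability.RandomPlanarGeometry.SAW.hexDomainMidEdges (Λ δ),
    ψ ((δ : ℂ) * Literature.Probability.RandomPlanarGeometry.SAW.hexMidpoint e) * spinFamily Λ x δ w e

/-- The box `U_ε = {|Re w| < ε, −5/8 − ε < Im w < ε}` around the segment joining the real axis to `w⋆`. -/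
def spinBox (ε : ℝ) : Set ℂ :=
  {w : ℂ | -ε < w.re ∧ w.re < ε ∧ -(5 / 8 : ℝ) - ε < w.im ∧ w.im < ε}

/-- A SPIN ANCHOR at aperture `ε`: a bulk test function `ψ₀` whose spin-tilt pairing is eventually zero-free on
the box `U_ε` and eventually dominates every bulk pairing uniformly on `U_ε`. -/
def IsSpinAnchor (D : DobrushinDomain) (p : ℂ) (Λ : ℝ → Finset HexVertex) (x : ℝ → Site 2) (ε : ℝ)
    (ψ₀ : ℂ → ℂ) : Prop :=
  IsBulkTest D p ψ₀ ∧
  (∀ᶠ δ : ℝ in nhdsWithin 0 (Set.Ioi 0), ∀ w ∈ spinBox ε, spinPairing Λ x ψ₀ δ w ≠ 0) ∧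
  ∀ ψ : ℂ → ℂ, IsBulkTest D p ψ → ∃ C : ℝ, ∀ᶠ δ : ℝ in nhdsWithin 0 (Set.Ioi 0),
    ∀ w ∈ spinBox ε, ‖spinPairing Λ x ψ δ w‖ ≤ C * ‖spinPairing Λ x ψ₀ δ w‖

/-! ### 2. The three statements of the line, named -/

/-- **V1, named — Vitali–Porter along `δ → 0⁺`** (classical). -/
def VitaliPorter : Prop :=
  ∀ (U S : Set ℂ) (F : ℝ → ℂ → ℂ) (f : ℂ → ℂ), IsOpen U → IsPreconnected U → S ⊆ U →
    (∃ z₀ ∈ U, z₀ ∈ closure (S \ {z₀})) →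
    (∀ᶠ δ : ℝ in nhdsWithin 0 (Set.Ioi 0), DifferentiableOn ℂ (F δ) U) →
    (∃ M : ℝ, ∀ᶠ δ : ℝ in nhdsWithin 0 (Set.Ioi 0), ∀ z ∈ U, ‖F δ z‖ ≤ M) →
    (∀ z ∈ S, Filter.Tendsto (fun δ => F δ z) (nhdsWithin 0 (Set.Ioi 0)) (nhds (f z))) →
    ∀ z ∈ U, ∃ c : ℂ, Filter.Tendsto (fun δ => F δ z) (nhdsWithin 0 (Set.Ioi 0)) (nhds c)

/-- **V3, named — a spin anchor exists** (the strip a-priori bound). -/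
def SpinAnchor : Prop :=
  ∀ (D : DobrushinDomain) (p : ℂ) (ρ : ℝ) (Λ : ℝ → Finset HexVertex) (x : ℝ → Site 2),
    Admissible D p ρ Λ x → ∃ ε : ℝ, 0 < ε ∧ ∃ ψ₀ : ℂ → ℂ, IsSpinAnchor D p Λ x ε ψ₀

/-- **V2, named — the positive-world limit**: real-tilt ratios converge. -/
def RealSpinLimit : Prop :=
  ∀ (D : DobrushinDomain) (p : ℂ) (ρ : ℝ) (Λ : ℝ → Finset HexVertex) (x : ℝ → Site 2),
    Admissible D p ρ Λ x → ∀ ε : ℝ, 0 < ε → ∀ ψ₀ : ℂ → ℂ, IsSpinAnchor D p Λ x ε ψ₀ →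
      ∀ s : ℝ, |s| < ε → ∀ ψ : ℂ → ℂ, IsBulkTest D p ψ → ∃ c : ℂ,
        Filter.Tendsto (fun δ : ℝ => spinPairing Λ x ψ δ (s : ℂ) / spinPairing Λ x ψ₀ δ (s : ℂ))
          (nhdsWithin 0 (Set.Ioi 0)) (nhds c)

/-- The crux with its three `let`s delta-reduced into the §1 vocabulary (definitionally the route decl). -/
def BulkScalingLimitExists' : Prop :=
  ∀ (D : DobrushinDomain) (p : ℂ) (ρ : ℝ) (Λ : ℝ → Finset HexVertex) (x : ℝ → Site 2),
    p ∈ D.carrier → 0 < ρ → Metric.ball p ρ ⊆ D.carrier →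
    (∀ᶠ δ : ℝ in nhdsWithin 0 (Set.Ioi 0),
      Literature.Probability.RandomPlanarGeometry.SAW.hexDomainSimplyConnected (Λ δ) ∧
      (hexGraph.induce ((Λ δ : Finset HexVertex) : Set HexVertex)).Preconnected ∧
      (∀ v ∈ Λ δ, (δ : ℂ) * hexCenter v ∈ D.carrier) ∧
      (∀ v : HexVertex, (δ : ℂ) * hexCenter v ∈ Metric.ball p ρ → v ∈ Λ δ)) →
    (∀ K : Set ℂ, IsCompact K → K ⊆ D.carrier → ∀ᶠ δ : ℝ in nhdsWithin 0 (Set.Ioi 0),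
      ∀ v : HexVertex, (δ : ℂ) * hexCenter v ∈ K → v ∈ Λ δ) →
    Filter.Tendsto (fun δ : ℝ => (δ : ℂ) * triEmbed (x δ)) (nhdsWithin 0 (Set.Ioi 0)) (nhds p) →
    ∃ (n : ℝ → ℂ) (ℓ : (ℂ → ℂ) → ℂ),
      (∃ ψ₀ : ℂ → ℂ, Continuous ψ₀ ∧ HasCompactSupport ψ₀ ∧ tsupport ψ₀ ⊆ D.carrier \ {p} ∧ ℓ ψ₀ ≠ 0) ∧
      ∀ ψ : ℂ → ℂ, Continuous ψ → HasCompactSupport ψ → tsupport ψ ⊆ D.carrier \ {p} →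
        Filter.Tendsto (fun δ : ℝ => n δ * (δ : ℂ) ^ 2 *
          ∑ᶠ e ∈ Literature.Probability.RandomPlanarGeometry.SAW.hexDomainMidEdges (Λ δ),
            ψ ((δ : ℂ) * Literature.Probability.RandomPlanarGeometry.SAW.hexMidpoint e) * Ftw Λ x δ e)
          (nhdsWithin 0 (Set.Ioi 0)) (nhds (ℓ ψ))

/-- The primed form IS the route decl (delta/zeta reduction of the three `let`s). -/
theorem bulkScalingLimitExists_iff :
    BulkScalingLimitExists' ↔
      Summit.CriticalPhenomena.SAWScalingLimit.Theses.SAWQuarterTwist.BulkScalingLimitExists :=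
  Iff.rfl

/-! ### 3. The registered stubs (the ONLY `sorry`s of this file) -/

/-- **V1 — Vitali–Porter along `𝓝[>] 0`** (CLASSICAL; deterministic functional analysis, landable now, size L).
A family `F δ` of functions holomorphic on a connected open `U ⊆ ℂ`, eventually (as `δ → 0⁺`) uniformly bounded
on `U`, converging pointwise on a set `S ⊆ U` that accumulates at a point of `U`, converges pointwise on `U`.
Proof in print: Montel (Cauchy estimates ⇒ local equicontinuity ⇒ Arzelà–Ascoli) + identity theorem for the
difference of two subsequential limits + the subsequence principle on the countably generated filter `𝓝[>] 0`
(Remmert, *Classical topics in complex function theory*, §7.3; Schiff, *Normal families*, §2.4). -/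
theorem stub_vitaliPorter :
    ∀ (U S : Set ℂ) (F : ℝ → ℂ → ℂ) (f : ℂ → ℂ), IsOpen U → IsPreconnected U → S ⊆ U →
      (∃ z₀ ∈ U, z₀ ∈ closure (S \ {z₀})) →
      (∀ᶠ δ : ℝ in nhdsWithin 0 (Set.Ioi 0), DifferentiableOn ℂ (F δ) U) →
      (∃ M : ℝ, ∀ᶠ δ : ℝ in nhdsWithin 0 (Set.Ioi 0), ∀ z ∈ U, ‖F δ z‖ ≤ M) →
      (∀ z ∈ S, Filter.Tendsto (fun δ => F δ z) (nhdsWithin 0 (Set.Ioi 0)) (nhds (f z))) →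
      ∀ z ∈ U, ∃ c : ℂ, Filter.Tendsto (fun δ => F δ z) (nhdsWithin 0 (Set.Ioi 0)) (nhds c) := by
  sorry

/-- **V3 — a spin anchor exists** (OPEN; the a-priori bound of the line, on a strip): for admissible data there
are an aperture `ε > 0` and a bulk test function `ψ₀` whose spin-tilt pairing `E_δ(w; ψ₀)` is eventually
zero-free on the box `U_ε` and eventually dominates every bulk pairing uniformly on `U_ε`
(`‖E_δ(w;ψ)‖ ≤ C_ψ ‖E_δ(w;ψ₀)‖`). Why plausibly true: along `Im w ∈ [−5/8, 0]` the undirected spin-tilt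
observable has ONE leading channel at each end, varying analytically in `w` (no channel crossing: card §F2), so
`E_δ(w;ψ) ≈ A(w) δ^{x(w)} ∫ψ f_w` with the SAME power for all `ψ` supported in a compact, and an anchor with
`∫ψ₀ f_w` zero-free on the compact box exists; why it might fail: the two-sided power-law cancellation bound,
uniform over targets in a compact, needs multi-scale decoupling of winding increments for critical SAW
(sub-RSW positive-measure input, not in print). -/
theorem stub_spinAnchor :
    ∀ (D : DobrushinDomain) (p : ℂ) (ρ : ℝ) (Λ : ℝ → Finset HexVertex) (x : ℝ → Site 2),
      Admissible D p ρ Λ x → ∃ ε : ℝ, 0 < ε ∧ ∃ ψ₀ : ℂ → ℂ, IsSpinAnchor D p Λ x ε ψ₀ := by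
  sorry

/-- **V2 (HARDEST) — the positive-world limit** (OPEN): for admissible data, every spin anchor `ψ₀` and every
real tilt `s ∈ (−ε, ε)`, the ratios `E_δ(s;ψ)/E_δ(s;ψ₀)` converge as `δ → 0⁺` for every bulk test function
`ψ`. For real `s` every walk weight is `x_c^ℓ e^{sT(γ)} > 0`: these are smeared two-point functions of the
turn-and-flux-tilted critical SAW from the interior source, MONOTONE in the domain `Λ` (squeeze between inner and
outer canonical discretisations disposes of the arbitrary admissible family), sub/super-multiplicative under
concatenation, with Helly-compact normalised subsequential limits; what is open is the UNIQUENESS of the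
projective limit of a positive critical two-point shape in a Jordan domain (bet: Birkhoff contraction of the
positive cut-circle renewal kernels, which on the positive axis needs no aperture condition). -/
theorem stub_realSpinLimit :
    ∀ (D : DobrushinDomain) (p : ℂ) (ρ : ℝ) (Λ : ℝ → Finset HexVertex) (x : ℝ → Site 2),
      Admissible D p ρ Λ x → ∀ ε : ℝ, 0 < ε → ∀ ψ₀ : ℂ → ℂ, IsSpinAnchor D p Λ x ε ψ₀ →
        ∀ s : ℝ, |s| < ε → ∀ ψ : ℂ → ℂ, IsBulkTest D p ψ → ∃ c : ℂ,
          Filter.Tendsto (fun δ : ℝ => spinPairing Λ x ψ δ (s : ℂ) / spinPairing Λ x ψ₀ δ (s : ℂ))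
            (nhdsWithin 0 (Set.Ioi 0)) (nhds c) := by
  sorry

/-! ### Consistency: each named statement IS its registered stub (definitionally) -/

theorem vitaliPorter_holds : VitaliPorter := stub_vitaliPorter
theorem spinAnchor_holds : SpinAnchor := stub_spinAnchor
theorem realSpinLimit_holds : RealSpinLimit := stub_realSpinLimit

/-! ### Name-keyed aliases of the three statements — the hypotheses of `BulkScalingLimitExists_of` -/
namespace __Registered

/-- Alias of `VitaliPorter` keyed by the registered stub name. -/
abbrev stub_vitaliPorter : Prop := VitaliPorter
/-- Alias of `SpinAnchor` keyed by the registered stub name. -/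
abbrev stub_spinAnchor : Prop := SpinAnchor
/-- Alias of `RealSpinLimit` keyed by the registered stub name. -/
abbrev stub_realSpinLimit : Prop := RealSpinLimit

end __Registered

/-! ### 4. The sorry-free part -/

/-- At the physical point the spin-tilt family IS the quarter-twisted parafermion: `E_s(w⋆; z) = F^tw_s(z)`. -/
theorem spinFamily_wstar (Λ : ℝ → Finset HexVertex) (x : ℝ → Site 2) (s : ℝ) (z : Sym2 HexVertex) :
    spinFamily Λ x s wstar z = Ftw Λ x s z := by
  unfold spinFamily Ftw
  refine Finset.sum_congr rfl fun γ _ => ?_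
  rw [sub_self, zero_mul, Complex.exp_zero, mul_one]
  rfl

/-- Hence the spin-tilt pairing at `w⋆` IS the crux's smeared pairing. -/
theorem spinPairing_wstar (Λ : ℝ → Finset HexVertex) (x : ℝ → Site 2) (ψ : ℂ → ℂ) (δ : ℝ) :
    spinPairing Λ x ψ δ wstar = pairing Λ x ψ δ := by
  unfold spinPairing pairing
  exact finsum_congr fun e => by rw [spinFamily_wstar]

/-- **The positive locus, certified**: for REAL `w = t` every summand of the spin-tilt family is the
positive real number `x_c^ℓ e^{tT(γ)}` — the phases `e^{-i(5/8)W} i^N` are exactly absorbed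
(`e^{w⋆T} = e^{-i5W/8} i^N`). This is the lattice content of "complexify the spin along the line through the
positive point": `E_δ(t; ψ)` for `t ∈ ℝ` and `ψ ≥ 0` is a sum of positive terms. -/
theorem spinFamily_ofReal (Λ : ℝ → Finset HexVertex) (x : ℝ → Site 2) (s t : ℝ) (z : Sym2 HexVertex) :
    spinFamily Λ x s (t : ℂ) z =
      ∑ γ : Literature.Probability.RandomPlanarGeometry.SAW.HexMidEdgeSAW (Λ s) (src x s) z,
        ((Literature.Probability.RandomPlanarGeometry.SAW.hexCriticalFugacity ^ γ.length *
          Real.exp (t * tcharge x s γ) : ℝ) : ℂ) := by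
  unfold spinFamily
  refine Finset.sum_congr rfl fun γ _ => ?_
  have hI : Complex.exp (↑(Real.pi / 2) * Complex.I) = Complex.I := by
    rw [Complex.exp_mul_I, ← Complex.ofReal_cos, ← Complex.ofReal_sin, Real.cos_pi_div_two,
      Real.sin_pi_div_two]
    simp
  have hIN : Complex.I ^ cutCount x s γ =
      Complex.exp (↑(cutCount x s γ) * (↑(Real.pi / 2) * Complex.I)) := by
    rw [Complex.exp_int_mul, hI]
  rw [hIN]
  unfold Literature.Probability.RandomPlanarGeometry.SAW.HexMidEdgeSAW.weight tcharge wstar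
  push_cast
  rw [mul_comm (Complex.exp _) (_ ^ _), mul_assoc, mul_assoc, ← Complex.exp_add, ← Complex.exp_add]
  congr 1
  congr 1
  ring

/-- In particular the real-tilt family is real and, termwise, positive. -/
theorem spinFamily_ofReal_pos (Λ : ℝ → Finset HexVertex) (x : ℝ → Site 2) (s t : ℝ) (z : Sym2 HexVertex)
    (γ : Literature.Probability.RandomPlanarGeometry.SAW.HexMidEdgeSAW (Λ s) (src x s) z) :
    0 < Literature.Probability.RandomPlanarGeometry.SAW.hexCriticalFugacity ^ γ.length *
      Real.exp (t * tcharge x s γ) :=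
  mul_pos (pow_pos Literature.Probability.RandomPlanarGeometry.SAW.hexCriticalFugacity_pos_lt_one.1 _) (Real.exp_pos _)

/-- The spin-tilt family is entire in `w` (a finite sum of exponentials). -/
theorem differentiable_spinFamily (Λ : ℝ → Finset HexVertex) (x : ℝ → Site 2) (s : ℝ) (z : Sym2 HexVertex) :
    Differentiable ℂ fun w => spinFamily Λ x s w z := by
  unfold spinFamily
  fun_prop

/-- The spin-tilt pairing is entire in `w` (the `finsum` is a genuine finite sum). -/
theorem differentiable_spinPairing (Λ : ℝ → Finset HexVertex) (x : ℝ → Site 2) (ψ : ℂ → ℂ) (δ : ℝ) :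
    Differentiable ℂ fun w => spinPairing Λ x ψ δ w := by
  have hfin := Summit.CriticalPhenomena.SAWScalingLimit.Theorems.MassRatio.Negative.hexDomainMidEdges_finite (Λ δ)
  have h : (fun w => spinPairing Λ x ψ δ w) = fun w => ∑ e ∈ hfin.toFinset,
      ψ ((δ : ℂ) * Literature.Probability.RandomPlanarGeometry.SAW.hexMidpoint e) * spinFamily Λ x δ w e := by
    funext w
    exact finsum_mem_eq_finite_toFinset_sum _ hfin
  rw [h]
  refine Differentiable.fun_sum fun e _ => ?_
  exact (differentiable_spinFamily Λ x δ e).const_mul _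

/-- The box `U_ε` is open. -/
theorem isOpen_spinBox (ε : ℝ) : IsOpen (spinBox ε) := by
  have h1 : IsOpen {w : ℂ | -ε < w.re} := isOpen_lt continuous_const Complex.continuous_re
  have h2 : IsOpen {w : ℂ | w.re < ε} := isOpen_lt Complex.continuous_re continuous_const
  have h3 : IsOpen {w : ℂ | -(5 / 8 : ℝ) - ε < w.im} := isOpen_lt continuous_const Complex.continuous_im
  have h4 : IsOpen {w : ℂ | w.im < ε} := isOpen_lt Complex.continuous_im continuous_const
  have : spinBox ε = {w : ℂ | -ε < w.re} ∩ {w : ℂ | w.re < ε} ∩ {w : ℂ | -(5 / 8 : ℝ) - ε < w.im} ∩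
      {w : ℂ | w.im < ε} := by
    ext w; simp only [spinBox, Set.mem_setOf_eq, Set.mem_inter_iff, and_assoc]
  rw [this]
  exact ((h1.inter h2).inter h3).inter h4

/-- The box `U_ε` is convex, hence preconnected. -/
theorem isPreconnected_spinBox (ε : ℝ) : IsPreconnected (spinBox ε) := by
  have hre : IsLinearMap ℝ fun w : ℂ => w.re := ⟨fun a b => Complex.add_re a b, fun c a => by simp⟩
  have him : IsLinearMap ℝ fun w : ℂ => w.im := ⟨fun a b => Complex.add_im a b, fun c a => by simp⟩
  have h1 : Convex ℝ {w : ℂ | -ε < w.re} := convex_halfSpace_gt hre _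
  have h2 : Convex ℝ {w : ℂ | w.re < ε} := convex_halfSpace_lt hre _
  have h3 : Convex ℝ {w : ℂ | -(5 / 8 : ℝ) - ε < w.im} := convex_halfSpace_gt him _
  have h4 : Convex ℝ {w : ℂ | w.im < ε} := convex_halfSpace_lt him _
  have : spinBox ε = {w : ℂ | -ε < w.re} ∩ {w : ℂ | w.re < ε} ∩ {w : ℂ | -(5 / 8 : ℝ) - ε < w.im} ∩
      {w : ℂ | w.im < ε} := by
    ext w; simp only [spinBox, Set.mem_setOf_eq, Set.mem_inter_iff, and_assoc]
  rw [this]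
  exact (((h1.inter h2).inter h3).inter h4).isPreconnected

/-- The physical point lies in every box of positive aperture. -/
theorem wstar_re : wstar.re = 0 := by simp [wstar]

theorem wstar_im : wstar.im = -(5 / 8 : ℝ) := by norm_num [wstar]

theorem wstar_mem_spinBox {ε : ℝ} (hε : 0 < ε) : wstar ∈ spinBox ε := by
  show -ε < wstar.re ∧ wstar.re < ε ∧ -(5 / 8 : ℝ) - ε < wstar.im ∧ wstar.im < ε
  rw [wstar_re, wstar_im]
  exact ⟨by linarith, hε, by linarith, by linarith⟩

/-- The real segment `(−ε, ε)` of the box. -/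
def realSeg (ε : ℝ) : Set ℂ := {w : ℂ | w.im = 0 ∧ |w.re| < ε}

theorem realSeg_subset_spinBox {ε : ℝ} (hε : 0 < ε) : realSeg ε ⊆ spinBox ε := by
  intro w hw
  obtain ⟨him, hre⟩ := hw
  rw [abs_lt] at hre
  simp only [spinBox, Set.mem_setOf_eq, him]
  refine ⟨hre.1, hre.2, by linarith, hε⟩

/-- `0` is an accumulation point of the real segment. -/
theorem zero_mem_closure_realSeg {ε : ℝ} (hε : 0 < ε) : (0 : ℂ) ∈ closure (realSeg ε \ {0}) := by
  rw [Metric.mem_closure_iff]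
  intro r hr
  refine ⟨((min (ε / 2) (r / 2) : ℝ) : ℂ), ⟨⟨by simp, ?_⟩, ?_⟩, ?_⟩
  · simp only [Complex.ofReal_re]
    rw [abs_lt]
    constructor
    · have : 0 < min (ε / 2) (r / 2) := lt_min (by linarith) (by linarith)
      linarith
    · exact (min_le_left _ _).trans_lt (by linarith)
  · simp only [Set.mem_singleton_iff, Complex.ofReal_eq_zero]
    exact (lt_min (by linarith) (by linarith)).ne'
  · rw [dist_comm, Complex.dist_eq, sub_zero, Complex.norm_real, Real.norm_eq_abs,
      abs_of_pos (lt_min (by linarith) (by linarith))]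
    exact (min_le_right _ _).trans_lt (by linarith)

/-- **The composition in the delta-reduced form** (no `sorry`): V1, V3, V2 imply `BulkScalingLimitExists'`. -/
theorem bulkScalingLimitExists'_of (h1 : VitaliPorter) (h3 : SpinAnchor) (h2 : RealSpinLimit) :
    BulkScalingLimitExists' := by
  intro D p ρ Λ x hp hρ hball hΛ hK hx
  have hAdm : Admissible D p ρ Λ x := ⟨hp, hρ, hball, hΛ, hK, hx⟩
  -- V3: aperture and anchor
  obtain ⟨ε, hε, ψ₀, hA⟩ := h3 D p ρ Λ x hAdm
  have hA0 : IsBulkTest D p ψ₀ := hA.1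
  have hne : ∀ᶠ δ : ℝ in nhdsWithin 0 (Set.Ioi 0), ∀ w ∈ spinBox ε, spinPairing Λ x ψ₀ δ w ≠ 0 := hA.2.1
  -- the key step: for every bulk ψ the normalised family converges at the physical point
  have key : ∀ ψ : ℂ → ℂ, IsBulkTest D p ψ → ∃ c : ℂ,
      Filter.Tendsto (fun δ : ℝ => spinPairing Λ x ψ δ wstar / spinPairing Λ x ψ₀ δ wstar)
        (nhdsWithin 0 (Set.Ioi 0)) (nhds c) := by
    intro ψ hψ
    -- the real-axis limits (V2), packaged as a function on ℂ
    have hreal : ∀ s : ℝ, |s| < ε → ∃ c : ℂ,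
        Filter.Tendsto (fun δ : ℝ => spinPairing Λ x ψ δ (s : ℂ) / spinPairing Λ x ψ₀ δ (s : ℂ))
          (nhdsWithin 0 (Set.Ioi 0)) (nhds c) :=
      fun s hs => h2 D p ρ Λ x hAdm ε hε ψ₀ hA s hs ψ hψ
    choose! g hg using hreal
    let F : ℝ → ℂ → ℂ := fun δ w => spinPairing Λ x ψ δ w / spinPairing Λ x ψ₀ δ w
    let f : ℂ → ℂ := fun w => g w.re
    -- hypotheses of Vitali–Porter
    have hdiff : ∀ᶠ δ : ℝ in nhdsWithin 0 (Set.Ioi 0), DifferentiableOn ℂ (F δ) (spinBox ε) := by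
      filter_upwards [hne] with δ hδ
      exact ((differentiable_spinPairing Λ x ψ δ).differentiableOn).div
        (differentiable_spinPairing Λ x ψ₀ δ).differentiableOn hδ
    obtain ⟨C, hC⟩ := hA.2.2 ψ hψ
    have hbdd : ∃ M : ℝ, ∀ᶠ δ : ℝ in nhdsWithin 0 (Set.Ioi 0), ∀ z ∈ spinBox ε, ‖F δ z‖ ≤ M := by
      refine ⟨C, ?_⟩
      filter_upwards [hne, hC] with δ hδ hCδ z hz
      have hpos : 0 < ‖spinPairing Λ x ψ₀ δ z‖ := norm_pos_iff.mpr (hδ z hz)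
      show ‖spinPairing Λ x ψ δ z / spinPairing Λ x ψ₀ δ z‖ ≤ C
      rw [norm_div, div_le_iff₀ hpos]
      exact hCδ z hz
    have hconv : ∀ z ∈ realSeg ε,
        Filter.Tendsto (fun δ => F δ z) (nhdsWithin 0 (Set.Ioi 0)) (nhds (f z)) := by
      intro z hz
      have hzre : |z.re| < ε := hz.2
      have hz' : ((z.re : ℝ) : ℂ) = z := Complex.ext (by simp) (by simp [hz.1])
      have := hg z.re hzre
      rw [hz'] at this
      exact this
    obtain ⟨c, hc⟩ := h1 (spinBox ε) (realSeg ε) F f (isOpen_spinBox ε) (isPreconnected_spinBox ε)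
      (realSeg_subset_spinBox hε)
      ⟨0, realSeg_subset_spinBox hε ⟨by simp, by simpa [realSeg] using hε⟩,
        zero_mem_closure_realSeg hε⟩
      hdiff hbdd hconv wstar (wstar_mem_spinBox hε)
    exact ⟨c, hc⟩
  choose! L hL using key
  refine ⟨fun δ => ((δ : ℂ) ^ 2 * spinPairing Λ x ψ₀ δ wstar)⁻¹, L,
    ⟨ψ₀, hA0.1, hA0.2.1, hA0.2.2, ?_⟩, ?_⟩
  · -- `L ψ₀ = 1`
    have h1' := hL ψ₀ hA0
    have hone : Filter.Tendsto (fun δ : ℝ => spinPairing Λ x ψ₀ δ wstar / spinPairing Λ x ψ₀ δ wstar)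
        (nhdsWithin 0 (Set.Ioi 0)) (nhds 1) := by
      refine tendsto_const_nhds.congr' ?_
      filter_upwards [hne] with δ hδ
      exact (div_self (hδ wstar (wstar_mem_spinBox hε))).symm
    rw [tendsto_nhds_unique h1' hone]
    exact one_ne_zero
  · intro ψ hψc hψs hψt
    have hψ : IsBulkTest D p ψ := ⟨hψc, hψs, hψt⟩
    refine (hL ψ hψ).congr' ?_
    have hpos : ∀ᶠ δ in nhdsWithin (0 : ℝ) (Set.Ioi 0), (0 : ℝ) < δ :=
      eventually_mem_nhdsWithin.mono fun δ hδ => hδ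
    filter_upwards [hpos] with δ hδ
    have hδ2 : (δ : ℂ) ^ 2 ≠ 0 := pow_ne_zero _ (Complex.ofReal_ne_zero.mpr hδ.ne')
    rw [spinPairing_wstar, spinPairing_wstar]
    show pairing Λ x ψ δ / pairing Λ x ψ₀ δ =
      ((δ : ℂ) ^ 2 * pairing Λ x ψ₀ δ)⁻¹ * (δ : ℂ) ^ 2 * pairing Λ x ψ δ
    rw [mul_inv, mul_right_comm ((δ : ℂ) ^ 2)⁻¹, inv_mul_cancel₀ hδ2, one_mul, ← div_eq_inv_mul]

/-! ### 5. The skeleton theorem: the three stubs imply the crux, BY NAME -/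

/-- **`BulkScalingLimitExists` from the line `spin-tilt-vitali`** (kernel-checked, no `sorry` of its own):
hypotheses = the three stubs under their registered names; conclusion = the route decl, by name. -/
theorem BulkScalingLimitExists_of (h1 : __Registered.stub_vitaliPorter)
    (h3 : __Registered.stub_spinAnchor) (h2 : __Registered.stub_realSpinLimit) :
    Summit.CriticalPhenomena.SAWScalingLimit.Theses.SAWQuarterTwist.BulkScalingLimitExists :=
  bulkScalingLimitExists_iff.mp (bulkScalingLimitExists'_of h1 h3 h2)

/-- Wiring check: the registered stubs, with their stated types, feed the skeleton theorem. -/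
example : Summit.CriticalPhenomena.SAWScalingLimit.Theses.SAWQuarterTwist.BulkScalingLimitExists :=
  BulkScalingLimitExists_of stub_vitaliPorter stub_spinAnchor stub_realSpinLimit

end Summit.CriticalPhenomena.SAWScalingLimit.Cruxes.BulkScalingLimitExists.SpinTiltVitali

end
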